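import Mathlib.Tactic
import Literature.Computability.Complexity.PromiseAdleman
import Literature.Computability.Complexity.PolyAdviceClosure
import Literature.Computability.Complexity.AdviceBasics
import Literature.Computability.Complexity.CircuitEval
import Literature.Computability.Complexity.CircuitClassesUniformProofs
import Literature.Computability.Complexity.PairProjections
import Literature.Computability.Cryptography.ClassBQPProofs
import Summits.QuantumAdvantage.QuantumAdvantage.Statement
import Summits.QuantumAdvantage.QuantumAdvantage.Theorems.SoloInformedHardLanguage
import Summits.QuantumAdvantage.QuantumAdvantage.Theorems.SoloInformedPromiseLiftPP
import Summits.QuantumAdvantage.QuantumAdvantage.Theorems.SoloInformedDoorFloor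
import HarnessLib

/-!
# SoloInformedNonuniformLift — advice dissolves the classical door, not the quantum one

Solo seat `solo-QuantumAdvantage-informed`, session 3, file 15. The seat's THEOREM MAP has three
uniform "doors" (promise→language canonisation hypotheses):
`Q-EXT := PromiseBQP ⊆ promiseLift BQP` (file 1), `H₀ := PromiseBPP' ⊆ promiseLift BQP` and
`C-EXT' := PromiseBPP' ⊆ PromiseBPP` (file 13, `SoloInformedDoorFloor`). This file records what
polynomial ADVICE does to them, over the tree's Karp–Lipton advice operator `polyAdvice`
(`C/poly`, Arora–Barak Def. 6.16) and circuit class `PPoly`: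

* **The classical doors become theorems.** `PromiseBPP' ⊆ promiseLift PPoly = promiseLift (P/poly)`
  is Adleman's argument run on the promise (tree theorem `PromiseBPP'_subset_promiseLift_PPoly`,
  `PromiseAdleman.lean`); hence also `H₀/poly : PromiseBPP' ⊆ promiseLift (BQP/poly)`
  (`classicalPromisesLiftPoly`). Adleman's proof canonises by FIXING THE COINS (one coin string per
  length, supplied as advice / hardwired), after which canonicity is free: a deterministic circuit
  has one answer on every input, on or off the promise.
* **The quantum door does not visibly move.** `Q-EXT/poly := PromiseBQP ⊆ promiseLift (BQP/poly)`
  ("every `PromiseBQP` problem agrees on its promise with a language decided, with bounded error on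
  ALL inputs, by a quantum machine with polynomial classical advice") is implied by `Q-EXT`
  (`promiseIsLiftPoly_of_promiseIsLift`) and sits in the same kind of bracket as `Q-EXT`:
  it HOLDS if `PP ⊆ P/poly` (`promiseIsLiftPoly_of_PP_subset_PPoly`; so it is not summit-strength:
  `promiseIsLiftPoly_and_not_quantumAdvantage_of_PP_subset_BPP`), and its failure proves
  `PP ⊄ P/poly` (`not_PP_subset_PPoly_of_not_promiseIsLiftPoly`), a non-uniform lower bound beyond
  present technique. Quantum coins cannot be fixed by advice (the Born rule is not a random tape), so
  the only ingredient of Adleman's proof that advice supplies is unavailable, and what remains is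
  exactly the canonical-value requirement of file 5 — now for advised machines.
* **The non-uniform assembly.** With `PSep/poly := PromiseBQP ⊄ promiseLift PPoly` (some
  `PromiseBQP` problem is solved by no polynomial-size circuit family — implied by, and much weaker
  than, the standard non-uniform hardness of FACTORING):
  `Q-EXT/poly ∧ PSep/poly ⟹ BQP ⊄ P/poly ⟹ QuantumAdvantage`
  (`not_BQP_subset_PPoly_of_promiseIsLiftPoly`, `quantumAdvantage_of_promiseIsLiftPoly`), and under
  `Q-EXT/poly` the non-uniform summit `BQP ⊄ P/poly` is EQUIVALENT to `PSep/poly`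
  (`not_BQP_subset_PPoly_iff_promiseSepPoly`). Compared with file 1 (`Q-EXT ∧ PSep ⟹ summit`) the
  structural hypothesis got weaker (advice allowed) and the quantitative one stronger
  (`PSep/poly ⟹ PSep`, `promiseSep_of_promiseSepPoly`); the conclusion passes through the
  natural-proofs-exposed statement `BQP ⊄ P/poly` (barrier entry
  `Literature.Barriers.QuantumAdvantage.NaturalProofs`).
* **Dichotomy.** `Q-EXT/poly ∨ PSep/poly` holds outright (`promiseIsLiftPoly_or_promiseSepPoly`):
  either every quantum promise problem is canonised by advised quantum machines, or one of them
  already defeats all polynomial-size classical circuits.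

All proofs are short compositions of tree theorems (Adleman for promise problems, `(P/poly)/poly ⊆
P/poly`, `P/poly = P/poly-advice`, `BPP ⊆ P/poly`, `P ⊆ BQP ⊆ PP`, `PromiseBQP ⊆ promiseLift PP`,
closure of `BQP` under Karp reductions).

## References
* [Adleman1978] L. Adleman, *Two theorems on random polynomial time*, FOCS 1978, 75–83
  (tree: `PromiseBPP'_subset_promiseLift_PPoly`, `BPP_subset_PPoly_holds`).
* [KarpLipton1980] R. M. Karp, R. J. Lipton, *Some connections between nonuniform and uniform
  complexity classes*, STOC 1980, 302–309 (advice; tree `polyAdvice`, `PPoly_eq_polyAdvice_P_holds`).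
* [AroraBarakCC2009] S. Arora, B. Barak, *Computational Complexity*, CUP 2009, Def. 6.16, Thm. 6.18,
  Thm. 7.14.
* [Goldreich2006] O. Goldreich, *On promise problems: a survey*, LNCS 3895 (2006), Def. 1.2, §1.2.
* [NishimuraYamakami2004] H. Nishimura, T. Yamakami, *Polynomial time quantum computation with
  advice*, Inform. Process. Lett. 90 (2004) 195–204 (`BQP/poly` in the Karp–Lipton sense).
* [AdlemanDeMarraisHuang1997] L. Adleman, J. DeMarrais, M.-D. Huang, *Quantum computability*,
  SIAM J. Comput. 26 (1997), Thm. 6.4 (tree: `PromiseBQP_subset_promiseLift_PP`, `BQP_subset_PP_holds`).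
-/

noncomputable section

namespace Summit.QuantumAdvantage.QuantumAdvantage.Theorems

open _root_.Computability Literature.Computability.Complexity Literature.Computability.Cryptography
  Literature.Computability.QuantumComplexity
open scoped Literature.Computability.Complexity.Notation

/-! ### The classical doors with advice are theorems -/

/-- **`C-EXT/poly` (Adleman on the promise), advice form**: every textbook promise-`BPP` problem is
solved by a language of `P/poly-advice = polyAdvice P` (tree: `PromiseBPP'_subset_promiseLift_PPoly`,
`PPoly_eq_polyAdvice_P_holds`). [cite: Adleman1978] [cite: AroraBarakCC2009, Thm. 7.14 and Thm. 6.18] -/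
theorem PromiseBPP'_subset_promiseLift_polyAdvice_P : PromiseBPP' ⊆ promiseLift (polyAdvice Classes.P) := by
  rw [← PPoly_eq_polyAdvice_P_holds]
  exact PromiseBPP'_subset_promiseLift_PPoly

/-- The strong promise class too: `PromiseBPP = promiseLift BPP ⊆ promiseLift PPoly`
(`BPP ⊆ P/poly`). [cite: Adleman1978] -/
theorem PromiseBPP_subset_promiseLift_PPoly : PromiseBPP ⊆ promiseLift PPoly :=
  promiseLift_mono fun _ hL => BPP_subset_PPoly_holds hL

/-- `P/poly ⊆ BQP/poly`: `PPoly = polyAdvice P ⊆ polyAdvice BQP` (`P ⊆ BQP`, tree theorem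
`P_subset_BQP_holds`). [cite: AroraBarakCC2009, Thm. 6.18] -/
theorem PPoly_subset_polyAdvice_BQP : PPoly ⊆ polyAdvice BQP :=
  PPoly_subset_polyAdvice_P.trans (polyAdvice_mono fun _ hL => P_subset_BQP_holds hL)

/-- **`H₀/poly` is a theorem**: every textbook promise-`BPP` problem is solved by a `BQP/poly`
language (`PromiseBPP' ⊆ promiseLift PPoly ⊆ promiseLift (polyAdvice BQP)`). The uniform `H₀`
(`PromiseBPP' ⊆ promiseLift BQP`, file 13) is open. [cite: Adleman1978] [cite: Goldreich2006, §1.2] -/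
theorem classicalPromisesLiftPoly : PromiseBPP' ⊆ promiseLift (polyAdvice BQP) :=
  PromiseBPP'_subset_promiseLift_PPoly.trans (promiseLift_mono PPoly_subset_polyAdvice_BQP)

/-! ### `BQP ⊆ BQP/poly` and `Q-EXT ⟹ Q-EXT/poly` -/

/-- `BQP` is closed under precomposition with the first projection of the pairing:
`{w | (boolUnpair w).1 ∈ L} ∈ BQP` for `L ∈ BQP` (a Karp reduction by `boolUnpairFst_mem_FP`;
`BQP` is closed downward under `≤ₚ`, file 8). [cite: Watrous2009, §IV.3] -/
theorem boolUnpairFst_preimage_mem_BQP {L : Language Bool} (hL : L ∈ BQP) :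
    {w | (boolUnpair w).1 ∈ L} ∈ BQP :=
  mem_BQP_of_karpReducible_BQP ⟨fun z => (boolUnpair z).1, boolUnpairFst_mem_FP, fun _ => Iff.rfl⟩ hL

/-- **`BQP ⊆ BQP/poly`** (empty advice). [cite: AroraBarakCC2009, Def. 6.16] -/
theorem BQP_subset_polyAdvice_BQP : BQP ⊆ polyAdvice BQP :=
  subset_polyAdvice_of_closed_fst BQP fun _ hL => boolUnpairFst_preimage_mem_BQP hL

/-- **`Q-EXT ⟹ Q-EXT/poly`**: the uniform quantum door implies the advised one.
[cite: Goldreich2006, Def. 1.2] -/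
theorem promiseIsLiftPoly_of_promiseIsLift (hExt : PromiseBQP ⊆ promiseLift BQP) :
    PromiseBQP ⊆ promiseLift (polyAdvice BQP) :=
  hExt.trans (promiseLift_mono BQP_subset_polyAdvice_BQP)

/-! ### The bracket around `Q-EXT/poly` -/

/-- **`¬PSep/poly ⟹ Q-EXT/poly`**: if every `PromiseBQP` problem is solved by polynomial-size
circuits then it is solved by a `BQP/poly` language (`P/poly ⊆ BQP/poly`). [cite: AroraBarakCC2009, Thm. 6.18] -/
theorem promiseIsLiftPoly_of_promiseBQP_subset_promiseLift_PPoly (h : PromiseBQP ⊆ promiseLift PPoly) :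
    PromiseBQP ⊆ promiseLift (polyAdvice BQP) :=
  h.trans (promiseLift_mono PPoly_subset_polyAdvice_BQP)

/-- **Non-uniform lift dichotomy**: `Q-EXT/poly ∨ PSep/poly`, outright. [folklore] -/
theorem promiseIsLiftPoly_or_promiseSepPoly :
    PromiseBQP ⊆ promiseLift (polyAdvice BQP) ∨ ¬ PromiseBQP ⊆ promiseLift PPoly := by
  by_cases h : PromiseBQP ⊆ promiseLift PPoly
  · exact Or.inl (promiseIsLiftPoly_of_promiseBQP_subset_promiseLift_PPoly h)
  · exact Or.inr h

/-- **`PP ⊆ P/poly ⟹ Q-EXT/poly`** (every `PromiseBQP` problem is solved by a `PP` language,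
Adleman–DeMarrais–Huang counting; tree `PromiseBQP_subset_promiseLift_PP`).
[cite: AdlemanDeMarraisHuang1997, Thm. 6.4] -/
theorem promiseIsLiftPoly_of_PP_subset_PPoly (h : PP ⊆ PPoly) :
    PromiseBQP ⊆ promiseLift (polyAdvice BQP) :=
  promiseIsLiftPoly_of_promiseBQP_subset_promiseLift_PPoly
    (PromiseBQP_subset_promiseLift_PP.trans (promiseLift_mono h))

/-- **Refuting `Q-EXT/poly` proves `PP ⊄ P/poly`.** [cite: AdlemanDeMarraisHuang1997, Thm. 6.4] -/
theorem not_PP_subset_PPoly_of_not_promiseIsLiftPoly (h : ¬ PromiseBQP ⊆ promiseLift (polyAdvice BQP)) :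
    ¬ PP ⊆ PPoly := fun hPP =>
  h (promiseIsLiftPoly_of_PP_subset_PPoly hPP)

/-- Likewise `PSep/poly ⟹ PP ⊄ P/poly`. [cite: AdlemanDeMarraisHuang1997, Thm. 6.4] -/
theorem not_PP_subset_PPoly_of_promiseSepPoly (hSep : ¬ PromiseBQP ⊆ promiseLift PPoly) : ¬ PP ⊆ PPoly :=
  fun hPP => hSep (PromiseBQP_subset_promiseLift_PP.trans (promiseLift_mono hPP))

/-- **`Q-EXT/poly` is not summit-strength**: in a collapse world `PP ⊆ BPP` it HOLDS
(`PP ⊆ BPP ⊆ P/poly`) while the summit FAILS (file 2). [cite: Adleman1978]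
[cite: AdlemanDeMarraisHuang1997, Thm. 6.4] -/
theorem promiseIsLiftPoly_and_not_quantumAdvantage_of_PP_subset_BPP (h : PP ⊆ BPP) :
    PromiseBQP ⊆ promiseLift (polyAdvice BQP) ∧ ¬ QuantumAdvantage :=
  ⟨promiseIsLiftPoly_of_PP_subset_PPoly (h.trans fun _ hL => BPP_subset_PPoly_holds hL),
    (promiseIsLift_and_not_quantumAdvantage_of_PP_subset_BPP h).2⟩

/-! ### The non-uniform assembly: `Q-EXT/poly ∧ PSep/poly ⟹ BQP ⊄ P/poly ⟹ summit` -/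

/-- **`PSep/poly ⟹ PSep`** (both promise separations of the seat): a `PromiseBQP` problem outside
`promiseLift PPoly` is outside `PromiseBPP'` (Adleman on the promise) and outside
`PromiseBPP = promiseLift BPP`. [cite: Adleman1978] -/
theorem promiseSep_of_promiseSepPoly (hSep : ¬ PromiseBQP ⊆ promiseLift PPoly) :
    ¬ PromiseBQP ⊆ PromiseBPP' ∧ ¬ PromiseBQP ⊆ PromiseBPP :=
  ⟨fun h => hSep (h.trans PromiseBPP'_subset_promiseLift_PPoly),
    fun h => hSep (h.trans PromiseBPP_subset_promiseLift_PPoly)⟩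

/-- **`BQP ⊄ P/poly ⟹ PSep/poly`** (unconditionally): a `BQP` language outside `P/poly` is, as a
trivial-promise problem, a `PromiseBQP` problem solved by no `P/poly` language.
[cite: Goldreich2006, §1.1] -/
theorem promiseSepPoly_of_not_BQP_subset_PPoly (h : ¬ BQP ⊆ PPoly) : ¬ PromiseBQP ⊆ promiseLift PPoly := by
  intro hQ
  refine h fun L hL => ?_
  exact ofLanguage_mem_promiseLift_iff.1 (hQ (ofLanguage_mem_PromiseBQP_iff.2 hL))

/-- **`Q-EXT/poly ∧ PSep/poly ⟹ BQP ⊄ P/poly`**: if `BQP ⊆ P/poly` then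
`BQP/poly ⊆ (P/poly)/poly ⊆ P/poly`, so `Q-EXT/poly` would put `PromiseBQP` inside `promiseLift PPoly`.
[cite: AroraBarakCC2009, Thm. 6.18] [cite: Goldreich2006, Def. 1.2] -/
theorem not_BQP_subset_PPoly_of_promiseIsLiftPoly (hExt : PromiseBQP ⊆ promiseLift (polyAdvice BQP))
    (hSep : ¬ PromiseBQP ⊆ promiseLift PPoly) : ¬ BQP ⊆ PPoly := fun hB =>
  hSep (hExt.trans (promiseLift_mono (polyAdvice_subset_PPoly hB)))

/-- **Under `Q-EXT/poly` the non-uniform summit is the non-uniform promise separation**: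
`BQP ⊄ P/poly ↔ PSep/poly`. [cite: AroraBarakCC2009, Thm. 6.18] [cite: Goldreich2006, Def. 1.2] -/
theorem not_BQP_subset_PPoly_iff_promiseSepPoly (hExt : PromiseBQP ⊆ promiseLift (polyAdvice BQP)) :
    ¬ BQP ⊆ PPoly ↔ ¬ PromiseBQP ⊆ promiseLift PPoly :=
  ⟨promiseSepPoly_of_not_BQP_subset_PPoly, not_BQP_subset_PPoly_of_promiseIsLiftPoly hExt⟩

/-- **`BQP ⊄ P/poly ⟹ QuantumAdvantage`** (`BPP ⊆ P/poly`, Adleman). [cite: Adleman1978] -/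
theorem quantumAdvantage_of_not_BQP_subset_PPoly (h : ¬ BQP ⊆ PPoly) : QuantumAdvantage := by
  by_contra hQA
  exact h fun L hL => BPP_subset_PPoly_holds (BQP_subset_BPP_of_not_quantumAdvantage hQA hL)

/-- **The non-uniform assembly**: `Q-EXT/poly ∧ PSep/poly ⟹ QuantumAdvantage` — canonisation of
quantum promise problems by ADVISED quantum machines, together with one quantum promise problem beyond
polynomial-size circuits, proves `BQP ⊄ BPP` (through `BQP ⊄ P/poly`). Compare file 1
(`Q-EXT ∧ PSep ⟹ summit`): weaker structural hypothesis, stronger quantitative one.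
[cite: Adleman1978] [cite: AroraBarakCC2009, Thm. 6.18] [cite: Goldreich2006, Def. 1.2] -/
theorem quantumAdvantage_of_promiseIsLiftPoly (hExt : PromiseBQP ⊆ promiseLift (polyAdvice BQP))
    (hSep : ¬ PromiseBQP ⊆ promiseLift PPoly) : QuantumAdvantage :=
  quantumAdvantage_of_not_BQP_subset_PPoly (not_BQP_subset_PPoly_of_promiseIsLiftPoly hExt hSep)

/-- **Without quantum advantage, `Q-EXT/poly ↔ ¬PSep/poly`**: in a world `BQP ⊆ BPP` the advised
quantum door is exactly the statement that polynomial-size circuits solve every quantum promise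
problem (compare file 6: `¬summit ⟹ (Q-EXT ↔ ¬PSep)`). [cite: Adleman1978] [cite: Goldreich2006, Def. 1.2] -/
theorem promiseIsLiftPoly_iff_of_not_quantumAdvantage (h : ¬ QuantumAdvantage) :
    PromiseBQP ⊆ promiseLift (polyAdvice BQP) ↔ PromiseBQP ⊆ promiseLift PPoly := by
  refine ⟨fun hExt => ?_, promiseIsLiftPoly_of_promiseBQP_subset_promiseLift_PPoly⟩
  by_contra hSep
  exact h (quantumAdvantage_of_promiseIsLiftPoly hExt hSep)

end Summit.QuantumAdvantage.QuantumAdvantage.Theorems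

end
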